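import Literature.Topology.FourManifolds.BoundarySignature
import Literature.Topology.FourManifolds.InteriorConnected
import Literature.Topology.FourManifolds.InteriorManifold
import Literature.AlgebraicTopology.SingularHomology.FundamentalClassExistence
import Literature.AlgebraicTopology.SingularHomology.OrientationProofs
import Literature.AlgebraicTopology.SingularHomology.UniversalCoefficientsField
import Mathlib.LinearAlgebra.FiniteDimensional.Basic
import Mathlib.Algebra.Field.ZMod
import HarnessLib

/-!
# The top `ℤ/2`-cohomology of a closed connected component inside the closed model

Topic `Literature/Topology/FourManifolds`; proofs file of the fact seat of
`Literature.Topology.FourManifolds.HomotopySphere.exists_mem_signatureSet_iff_eight_dvd`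
(M. Kervaire, J. Milnor, *Groups of homotopy spheres I*, Ann. of Math. 77 (1963), §7, p. 530),
for the evenness of the intersection form of a DISCONNECTED s-parallelizable null-cobordism:
the Wu-class argument (`steenrodSqLower_eq_zero_of_tube`) on a closed connected component `V`
of `W` needs that `Hⁿ⁺¹(V; ℤ/2)` has a single nonzero element — A. Hatcher, *Algebraic Topology*
(2002), Thm. 3.26(a) with §3.3 p. 235 (every manifold is `ℤ/2`-orientable) and Thm. 3.2 over the
field `ℤ/2`. Here this is proved for the copy `V° = {x ∈ W° | x ∈ V}` of `V` inside the closed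
model `Ŵ = W ∪ cone(∂W)` (`ClosedModel n W`), for `V ⊆ W` open, closed, connected and contained
in the interior `W°`:

* `eq_of_ne_zero_singularCohomology_top_of_closed_manifold` — for a closed connected
  topological `d`-manifold `Z` (atlas on `ℝᵈ`), two nonzero classes of `Hᵈ(Z; ℤ/2)` are equal
  (`nonempty_homologicalOrientation_zmod_two`, `nonempty_singularHomology_top_iso_holds`,
  `finrank_singularCohomology_eq_bettiNumber_of_field`);
* `compactSpace_interiorManifold_opens`, `nonempty_interiorManifold_homeomorph_image_coe` — for
  `V ⊆ W` open, closed and contained in `W°`, the boundaryless manifold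
  `InteriorManifold (𝓡∂ (n+1)) ↥V` (all of `↥V`, re-modelled on `ℝⁿ⁺¹`, `InteriorManifold.lean`)
  is compact and homeomorphic to `V° ⊆ Ŵ`;
* `eq_of_ne_zero_singularCohomology_image_coe_top` — **two nonzero classes of
  `Hⁿ⁺¹(↥V°; ℤ/2)` are equal**, for `V` clopen, connected, `V ⊆ W°`.

Everything is proved; no definition, no named fact (D-0026).

## References

* A. Hatcher, *Algebraic Topology*, CUP 2002, Thm. 3.26(a), §3.3 p. 235, Thm. 3.2 (p. 198).
  [HatcherAT2002]
* M. Kervaire, J. Milnor, *Groups of homotopy spheres I*, Ann. of Math. 77 (1963), §7, footnote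
  pp. 528–529. [KervaireMilnorAnnals1963]
-/

open scoped Manifold ContDiff Topology
open Set Function CategoryTheory

noncomputable section

namespace Literature.Topology.FourManifolds

open Literature.AlgebraicTopology.SingularHomology

/-! ### Closed connected manifolds: one nonzero class in the top `ℤ/2`-cohomology -/

/-- **For a closed connected topological `d`-manifold `Z`, `Hᵈ(Z; ℤ/2)` has a single nonzero
element** (Hatcher Thm. 3.26(a): `H_d(Z; ℤ/2) ≅ ℤ/2` for the `ℤ/2`-orientation that every
manifold carries, p. 235; universal coefficients over the field `ℤ/2`, Thm. 3.2:
`dim Hᵈ = dim H_d = 1`; and `1` is the only nonzero scalar). [cite: HatcherAT2002, Thm. 3.26(a), §3.3 p. 235 and Thm. 3.2 (p. 198)] -/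
theorem eq_of_ne_zero_singularCohomology_top_of_closed_manifold {d : ℕ} {Z : Type}
    [TopologicalSpace Z] [T2Space Z] [CompactSpace Z] [ConnectedSpace Z]
    [ChartedSpace (EuclideanSpace ℝ (Fin d)) Z]
    {a b : singularCohomology (ZMod 2) (ZMod 2) Z d} (ha : a ≠ 0) (hb : b ≠ 0) : a = b := by
  haveI : Fact (Nat.Prime 2) := ⟨Nat.prime_two⟩
  obtain ⟨μ₂⟩ := nonempty_homologicalOrientation_zmod_two (X := Z) (n := d)
  obtain ⟨e⟩ := nonempty_singularHomology_top_iso_holds (R := ZMod 2) (X := Z) d μ₂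
  have h1 : Module.finrank (ZMod 2) (singularCohomology (ZMod 2) (ZMod 2) Z d) = 1 := by
    rw [finrank_singularCohomology_eq_bettiNumber_of_field, bettiNumber, e.toLinearEquiv.finrank_eq,
      (ULift.moduleEquiv (R := ZMod 2) (M := ZMod 2)).finrank_eq, Module.finrank_self]
  obtain ⟨r, hr⟩ := (finrank_eq_one_iff_of_nonzero' a ha).1 h1 b
  have hr0 : r ≠ 0 := by
    rintro rfl
    exact hb (by rw [← hr, zero_smul])
  have hr1 : r = 1 := by
    fin_cases r
    · exact absurd rfl hr0
    · rfl
  rw [← hr, hr1, one_smul]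

/-! ### The closed connected component `V` and its copy `V°` in the closed model -/

section Component

variable {n : ℕ} {W : Type} [TopologicalSpace W] [T2Space W] [CompactSpace W]
  [ChartedSpace (EuclideanHalfSpace (n + 1)) W] [IsManifold (𝓡∂ (n + 1)) ∞ W]

omit [T2Space W] [IsManifold (𝓡∂ (n + 1)) ∞ W] in
/-- For `V ⊆ W` open, closed and contained in `W°`, the boundaryless manifold
`InteriorManifold (𝓡∂ (n+1)) ↥V` is all of the compact `↥V`, hence compact. [folklore] -/
theorem compactSpace_interiorManifold_opens (V : TopologicalSpace.Opens W)
    (hVcl : IsClosed (V : Set W)) (hVint : (V : Set W) ⊆ (𝓡∂ (n + 1)).interior W) :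
    CompactSpace (InteriorManifold (𝓡∂ (n + 1)) (V : Type)) := by
  have hall : ∀ a : (V : Type), (𝓡∂ (n + 1)).IsInteriorPoint a := fun a =>
    (𝓡∂ (n + 1)).isInteriorPoint_iff_isInteriorPoint_val.2 (hVint a.2)
  haveI : CompactSpace (V : Type) := isCompact_iff_compactSpace.1 hVcl.isCompact
  have hsurj : Surjective
      (InteriorManifold.val : InteriorManifold (𝓡∂ (n + 1)) (V : Type) → (V : Type)) :=
    fun a => ⟨⟨a, hall a⟩, rfl⟩
  let φ : InteriorManifold (𝓡∂ (n + 1)) (V : Type) ≃ₜ (V : Type) :=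
    (InteriorManifold.isEmbedding_val.toHomeomorph).trans
      ((Homeomorph.setCongr (range_eq_univ.2 hsurj)).trans (Homeomorph.Set.univ _))
  exact φ.symm.compactSpace

/-- **`InteriorManifold (𝓡∂ (n+1)) ↥V ≃ₜ V° ⊆ Ŵ` for `V ⊆ W` open, closed, contained in
`W°`**: every point of the open submanifold `V` is an interior point
(`ModelWithCorners.isInteriorPoint_iff_isInteriorPoint_val`), so `z ↦ z.val` followed by the
open embedding `W° → Ŵ` is a continuous bijection from the compact `InteriorManifold (𝓡∂ (n+1)) ↥V`
onto the Hausdorff `V° = {x ∈ W° | x ∈ V}`. [folklore] -/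
theorem nonempty_interiorManifold_homeomorph_image_coe (V : TopologicalSpace.Opens W)
    (hVcl : IsClosed (V : Set W)) (hVint : (V : Set W) ⊆ (𝓡∂ (n + 1)).interior W) :
    Nonempty (InteriorManifold (𝓡∂ (n + 1)) (V : Type) ≃ₜ
      ↥((ClosedModel.ofInterior : ManifoldInterior n W → ClosedModel n W) ''
        {x | x.1 ∈ (V : Set W)})) := by
  -- every point of `↥V` is an interior point of the open submanifold `V`
  have hall : ∀ a : (V : Type), (𝓡∂ (n + 1)).IsInteriorPoint a := fun a =>
    (𝓡∂ (n + 1)).isInteriorPoint_iff_isInteriorPoint_val.2 (hVint a.2)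
  haveI : CompactSpace (InteriorManifold (𝓡∂ (n + 1)) (V : Type)) :=
    compactSpace_interiorManifold_opens V hVcl hVint
  -- the continuous bijection onto `V°`
  set T : Set (ClosedModel n W) :=
    (ClosedModel.ofInterior : ManifoldInterior n W → ClosedModel n W) '' {x | x.1 ∈ (V : Set W)}
  let F : InteriorManifold (𝓡∂ (n + 1)) (V : Type) → ↥T := fun z =>
    ⟨ClosedModel.ofInterior (⟨z.val.1, hVint z.val.2⟩ : ManifoldInterior n W),
      ⟨⟨z.val.1, hVint z.val.2⟩, z.val.2, rfl⟩⟩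
  have hFc : Continuous F := by
    refine Continuous.subtype_mk ?_ _
    have h1 : Continuous fun z : InteriorManifold (𝓡∂ (n + 1)) (V : Type) =>
        (⟨z.val.1, hVint z.val.2⟩ : ManifoldInterior n W) :=
      Continuous.subtype_mk (continuous_subtype_val.comp InteriorManifold.continuous_val) _
    exact OnePoint.continuous_coe.comp h1
  have hFi : Injective F := by
    intro z z' h
    have h' : (⟨z.val.1, hVint z.val.2⟩ : ManifoldInterior n W) = ⟨z'.val.1, hVint z'.val.2⟩ :=
      OnePoint.coe_injective (congrArg Subtype.val h)
    have h'' : z.val.1 = z'.val.1 := congrArg (fun x : ManifoldInterior n W => x.1) h'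
    exact InteriorManifold.val_injective (Subtype.ext h'')
  have hFs : Surjective F := by
    rintro ⟨_, x, hx, rfl⟩
    exact ⟨⟨⟨x.1, hx⟩, hall _⟩, rfl⟩
  exact ⟨Continuous.homeoOfEquivCompactToT2 (f := Equiv.ofBijective F ⟨hFi, hFs⟩) hFc⟩

/-- **Two nonzero classes of `Hⁿ⁺¹(↥V°; ℤ/2)` are equal** for the copy `V° ⊆ Ŵ` of a subset
`V ⊆ W` which is open, closed, connected and contained in the interior — a closed connected
component of `W` (Hatcher Thm. 3.26(a) on the closed connected `(n+1)`-manifold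
`InteriorManifold (𝓡∂ (n+1)) ↥V ≃ₜ ↥V°`). This is the hypothesis of
`steenrodSqLower_eq_zero_of_tube` for the closed components of a disconnected null-cobordism.
[cite: HatcherAT2002, Thm. 3.26(a), §3.3 p. 235 and Thm. 3.2 (p. 198)] -/
theorem eq_of_ne_zero_singularCohomology_image_coe_top (V : TopologicalSpace.Opens W)
    (hVcl : IsClosed (V : Set W)) (hVint : (V : Set W) ⊆ (𝓡∂ (n + 1)).interior W)
    (hVconn : IsConnected (V : Set W))
    {a b : singularCohomology (ZMod 2) (ZMod 2)
      (↥((ClosedModel.ofInterior : ManifoldInterior n W → ClosedModel n W) ''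
        {x | x.1 ∈ (V : Set W)})) (n + 1)}
    (ha : a ≠ 0) (hb : b ≠ 0) : a = b := by
  set T : Set (ClosedModel n W) :=
    (ClosedModel.ofInterior : ManifoldInterior n W → ClosedModel n W) '' {x | x.1 ∈ (V : Set W)}
    with hT
  haveI : ConnectedSpace (V : Type) := isConnected_iff_connectedSpace.1 hVconn
  obtain ⟨ψ⟩ := nonempty_interiorManifold_homeomorph_image_coe V hVcl hVint
  haveI : CompactSpace (InteriorManifold (𝓡∂ (n + 1)) (V : Type)) :=
    compactSpace_interiorManifold_opens V hVcl hVint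
  -- pull back along the homeomorphism and use Hatcher 3.26 on the closed connected manifold
  have hinj : Injective (singularCohomology.map (ZMod 2) (ZMod 2)
      (ψ : C(InteriorManifold (𝓡∂ (n + 1)) (V : Type), ↥T)) (n + 1)) := by
    intro x y h
    exact ((forget (ModuleCat (ZMod 2))).mapIso
      (singularCohomology.mapIso (ZMod 2) (ZMod 2) ψ (n + 1))).toEquiv.injective h
  apply hinj
  refine eq_of_ne_zero_singularCohomology_top_of_closed_manifold (d := n + 1)
    (Z := InteriorManifold (𝓡∂ (n + 1)) (V : Type)) ?_ ?_
  · exact fun h => ha (hinj (h.trans (map_zero _).symm))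
  · exact fun h => hb (hinj (h.trans (map_zero _).symm))

end Component

end Literature.Topology.FourManifolds
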